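import Literature.Probability.Percolation.ZdFourArmOutLandedExt
import Literature.Probability.Percolation.ZdFourArmSepInitProb
import HarnessLib

/-!
# Outward extension of the outer-landed four-arm event of bond percolation on `ℤ²`, probabilistic half

Topic `Literature/Probability/Percolation`; critical bond percolation on `ℤ²`
(`bondPercolation (zdGraph 2) half`). Proofs and two auxiliary pair-set definitions (no named fact).

The **extension input `hext` of the EXTERNAL half of Kesten's arm-separation scheme** for four
alternating arms (H. Kesten, CMP 109 (1987), §2 Lemma 4; P. Nolin, EJP 13 (2008), §4.3 Prop. 12 (i)
and §4.4 p. 12, the constant `C'₀`: "going from `∂S_m` to `∂S_{2m}` has a cost `C'₀` depending only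
on `η'₀`"), read on the tree's outer-landed event (`ZdFourArmOutLanded.lean`; the `H K` of
`real_fourArmTwoClusters_le_mul_of_scheme`, `ZdFourArmSeparationStep.lean`):

  `P(zdFourArmOutLanded n M) ≤ C₀ · P(zdFourArmOutLanded n (2M))`,  `128 ≤ n`, `2n ≤ M`,

with `C₀ = max 1 c⁻¹⁶`, `c` the Russo–Seymour–Welsh constant at aspect ratio `512`
(`exists_real_zdFourArmOutLanded_le_mul_outwardTo`; `…_outward` for `M' = 2M`). As for the inward extension of the
well-separated event (`ZdFourArmSepInwardExtProb.lean`): the outer-landed event is an increasing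
event (two outer-fenced open arms, read off the pairs of the right/left zones `zdSepZoneR/L n M`)
meet a decreasing one (two outer-fenced dual arms, top/bottom zones), the sixteen corridor events of
`ZdFourArmOutLandedExt.lean` live at `|x₀| ≥ M + 1` (open) and `|x₁| ≥ M + 1` (dual), off the zones
of the other colour, so Nolin's Lemma 13 (`bondPercolation_locallyMonotone_fkg`) with Harris and RSW
(`≥ c⁸` per class) gives `c¹⁶ P(OutLanded n M) ≤ P(OutLanded n M ∩ corridors) ≤ P(OutLanded n 2M)`
(`mem_zdFourArmOutLanded_of_mem_outward`).

* `outwardOpenPairsTo`, `outwardDualPairsTo`, sites lemmas, `disjoint_outwardPairsTo`,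
  `determinedBy_outwardOpenEventsTo/DualEvents`, `isUpperSet_…`, `isLowerSet_…`;
* `determinedBy_zdOutOpenArmR/L`, `determinedBy_zdOutDualArmT/B` — zone locality of the four parts;
* `le_real_outwardOpenEventsTo`, `le_real_outwardDualEventsTo` (`≥ c⁸`);
* `real_zdFourArmOutLanded_inter_outwardTo_ge`, `real_zdFourArmOutLanded_outwardTo_ge`,
  **`exists_real_zdFourArmOutLanded_le_mul_outwardTo`**.

## References

* P. Nolin, *Near-critical percolation in two dimensions*, EJP 13 (2008), §4.3 Prop. 12 (i),
  Lemma 13, §4.4 (arXiv 0711.4948: Prop. 11 (i), Lemma 12, p. 12) [Nolin2008].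
* H. Kesten, *Scaling relations for 2D-percolation*, CMP 109 (1987), §2 Lemma 4 [KestenScalingCMP1987].
* B. Bollobás, O. Riordan, *Percolation* (2006), Ch. 3, eq. (3) [BollobasRiordan2006].
-/

noncomputable section

open MeasureTheory Set SimpleGraph

namespace Literature.Probability.Percolation

open LatticeModels

/-! ### The pairs read by the sixteen corridor events -/

section Pairs

/-- The pairs read by the eight open corridor events. [folklore] -/
def outwardOpenPairsTo (M M' : ℕ) : Finset (Sym2 (Site 2)) :=
  (((rectangle (M' - M - 1) (M / 64)).image (· + (![(M : ℤ) + 1, 0] : Site 2))).sym2 ∪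
    (((rectangle (M' / 16 + M' / 8 - 1) (M' / 64)).image
          (· + (![(M' : ℤ) - (M' / 16 : ℕ), 0] : Site 2))).sym2 ∪
      (((rectangle (M' / 16 - 1) (3 * (M' / 64))).image
            (· + (![(M' : ℤ) - (M' / 16 : ℕ), -((M' / 64 : ℕ) : ℤ)] : Site 2))).sym2 ∪
        ((rectangle (M' / 8 - 2) (3 * (M' / 64))).image
            (· + (![(M' : ℤ) + 1, -((M' / 64 : ℕ) : ℤ)] : Site 2))).sym2))) ∪
  (((rectangle (M' - M - 1) (M / 64)).image (· + (![-(M' : ℤ), 0] : Site 2))).sym2 ∪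
    (((rectangle (M' / 16 + M' / 8 - 1) (M' / 64)).image
          (· + (![-(M' : ℤ) - (M' / 8 : ℕ) + 1, 0] : Site 2))).sym2 ∪
      (((rectangle (M' / 16 - 1) (3 * (M' / 64))).image
            (· + (![-(M' : ℤ) + 1, -((M' / 64 : ℕ) : ℤ)] : Site 2))).sym2 ∪
        ((rectangle (M' / 8 - 2) (3 * (M' / 64))).image
            (· + (![-(M' : ℤ) - (M' / 8 : ℕ) + 1, -((M' / 64 : ℕ) : ℤ)] : Site 2))).sym2)))

/-- The pairs read by the eight closed-dual corridor events. [folklore] -/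
def outwardDualPairsTo (M M' : ℕ) : Finset (Sym2 (Site 2)) :=
  (dualFaceCrossingPairs ![0, (M : ℤ) + 2] (M / 64 + 1) (M' - M - 2) ∪
    (dualLRFaceCrossingPairs ![-((M' / 64 : ℕ) : ℤ), (M' : ℤ) - (M' / 16 : ℕ) + 1]
        (3 * (M' / 64)) (M' / 16 - 2) ∪
      (dualFaceCrossingPairs ![0, (M' : ℤ) - (M' / 16 : ℕ) + 2] (M' / 64 + 1)
          (M' / 16 + M' / 8 - 3) ∪
        dualLRFaceCrossingPairs ![-((M' / 64 : ℕ) : ℤ), (M' : ℤ) + 1] (3 * (M' / 64))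
          (M' / 8 - 2)))) ∪
  (dualFaceCrossingPairs ![0, -(M' : ℤ)] (M / 64 + 1) (M' - M - 2) ∪
    (dualLRFaceCrossingPairs ![-((M' / 64 : ℕ) : ℤ), -(M' : ℤ)] (3 * (M' / 64)) (M' / 16 - 2) ∪
      (dualFaceCrossingPairs ![0, -(M' : ℤ) - (M' / 8 : ℕ) + 1] (M' / 64 + 1)
          (M' / 16 + M' / 8 - 3) ∪
        dualLRFaceCrossingPairs ![-((M' / 64 : ℕ) : ℤ), -(M' : ℤ) - (M' / 8 : ℕ)]
          (3 * (M' / 64)) (M' / 8 - 2))))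

variable {M M' : ℕ}

/-- **Sites of the open corridor pairs**: `|x₁| ≤ 2·(2M)/64` and `M + 1 ≤ |x₀| ≤ 2M + (2M)/8 - 1`. [folklore] -/
theorem outwardOpenPairsTo_sites (hM : 64 ≤ M) (hlo : 2 * M ≤ M') (hhi : M' ≤ 4 * M) {e : Sym2 (Site 2)}
    (he : e ∈ outwardOpenPairsTo M M') {x : Site 2}
    (hx : x ∈ e) :
    |x 1| ≤ 2 * ((M' / 64 : ℕ) : ℤ) ∧ (M : ℤ) + 1 ≤ |x 0| ∧ |x 0| + 1 ≤ (M' : ℤ) + (M' / 8 : ℕ) := by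
  simp only [outwardOpenPairsTo, Finset.mem_union] at he
  rcases he with (he | (he | (he | he))) | (he | (he | (he | he))) <;>
    have h := apply_le_of_mem_rectanglePairs he hx <;>
    simp only [Matrix.cons_val_zero, Matrix.cons_val_one] at h <;>
    (first
      | exact ⟨abs_le.2 ⟨by omega, by omega⟩, by rw [abs_of_nonneg (by omega)]; omega,
          by rw [abs_of_nonneg (by omega)]; omega⟩
      | exact ⟨abs_le.2 ⟨by omega, by omega⟩, by rw [abs_of_nonpos (by omega)]; omega,
          by rw [abs_of_nonpos (by omega)]; omega⟩)

/-- **Sites of the dual corridor pairs**: `|x₀| ≤ 2·(2M)/64 + 1` and `M + 1 ≤ |x₁| ≤ 2M + (2M)/8`. [folklore] -/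
theorem outwardDualPairsTo_sites (hM : 64 ≤ M) (hlo : 2 * M ≤ M') (hhi : M' ≤ 4 * M) {e : Sym2 (Site 2)}
    (he : e ∈ outwardDualPairsTo M M') {x : Site 2}
    (hx : x ∈ e) :
    |x 0| ≤ 2 * ((M' / 64 : ℕ) : ℤ) + 1 ∧ (M : ℤ) + 1 ≤ |x 1| ∧ |x 1| ≤ (M' : ℤ) + (M' / 8 : ℕ) := by
  simp only [outwardDualPairsTo, Finset.mem_union] at he
  rcases he with (he | (he | (he | he))) | (he | (he | (he | he))) <;>
    [have h := apply_le_of_mem_dualFaceCrossingPairs he hx;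
      have h := apply_le_of_mem_dualLRFaceCrossingPairs he hx;
      have h := apply_le_of_mem_dualFaceCrossingPairs he hx;
      have h := apply_le_of_mem_dualLRFaceCrossingPairs he hx;
      have h := apply_le_of_mem_dualFaceCrossingPairs he hx;
      have h := apply_le_of_mem_dualLRFaceCrossingPairs he hx;
      have h := apply_le_of_mem_dualFaceCrossingPairs he hx;
      have h := apply_le_of_mem_dualLRFaceCrossingPairs he hx] <;>
    simp only [Matrix.cons_val_zero, Matrix.cons_val_one] at h <;>
    (first
      | exact ⟨abs_le.2 ⟨by omega, by omega⟩, by rw [abs_of_nonneg (by omega)]; omega,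
          by rw [abs_of_nonneg (by omega)]; omega⟩
      | exact ⟨abs_le.2 ⟨by omega, by omega⟩, by rw [abs_of_nonpos (by omega)]; omega,
          by rw [abs_of_nonpos (by omega)]; omega⟩)

/-- The open and dual corridor pairs are disjoint. [folklore] -/
theorem disjoint_outwardPairsTo (hM : 64 ≤ M) (hlo : 2 * M ≤ M') (hhi : M' ≤ 4 * M) :
    Disjoint (outwardOpenPairsTo M M') (outwardDualPairsTo M M') := by
  rw [Finset.disjoint_left]
  intro e heP heM
  obtain ⟨x, hx⟩ : ∃ x, x ∈ e := ⟨e.out.1, Sym2.out_fst_mem e⟩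
  have h1 := outwardOpenPairsTo_sites hM hlo hhi heP hx
  have h2 := outwardDualPairsTo_sites hM hlo hhi heM hx
  omega

/-- The open corridor events are determined by the open corridor pairs. [folklore] -/
theorem determinedBy_outwardOpenEventsTo (M M' : ℕ) :
    DeterminedBy (outwardOpenEventsTo M M') ↑(outwardOpenPairsTo M M') := by
  unfold outwardOpenEventsTo outwardOpenPairsTo
  exact ((determinedBy_openCrossing_image _ _ _ _).inter_finsetUnion
    ((determinedBy_openCrossing_image _ _ _ _).inter_finsetUnion
      ((determinedBy_openCrossing_image _ _ _ _).inter_finsetUnion (determinedBy_openCrossing_image _ _ _ _)))).inter_finsetUnion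
    ((determinedBy_openCrossing_image _ _ _ _).inter_finsetUnion
    ((determinedBy_openCrossing_image _ _ _ _).inter_finsetUnion
      ((determinedBy_openCrossing_image _ _ _ _).inter_finsetUnion (determinedBy_openCrossing_image _ _ _ _))))

/-- The dual corridor events are determined by the dual corridor pairs. [folklore] -/
theorem determinedBy_outwardDualEventsTo (M M' : ℕ) :
    DeterminedBy (outwardDualEventsTo M M') ↑(outwardDualPairsTo M M') := by
  unfold outwardDualEventsTo outwardDualPairsTo
  exact ((determinedBy_dualFaceCrossing _ _ _).inter_finsetUnion
    ((determinedBy_dualLRFaceCrossing _ _ _).inter_finsetUnion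
      ((determinedBy_dualFaceCrossing _ _ _).inter_finsetUnion (determinedBy_dualLRFaceCrossing _ _ _)))).inter_finsetUnion
    ((determinedBy_dualFaceCrossing _ _ _).inter_finsetUnion
    ((determinedBy_dualLRFaceCrossing _ _ _).inter_finsetUnion
      ((determinedBy_dualFaceCrossing _ _ _).inter_finsetUnion (determinedBy_dualLRFaceCrossing _ _ _))))

/-- The open corridor events are increasing. [folklore] -/
theorem isUpperSet_outwardOpenEventsTo (M M' : ℕ) : IsUpperSet (outwardOpenEventsTo M M') :=
  ((isUpperSet_lrCrossingAt _ _ _).inter ((isUpperSet_lrCrossingAt _ _ _).inter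
    ((isUpperSet_tbCrossingAt' _ _ _).inter (isUpperSet_tbCrossingAt' _ _ _)))).inter
    ((isUpperSet_lrCrossingAt _ _ _).inter ((isUpperSet_lrCrossingAt _ _ _).inter
      ((isUpperSet_tbCrossingAt' _ _ _).inter (isUpperSet_tbCrossingAt' _ _ _))))

/-- The dual corridor events are decreasing. [folklore] -/
theorem isLowerSet_outwardDualEventsTo (M M' : ℕ) : IsLowerSet (outwardDualEventsTo M M') :=
  ((isLowerSet_dualFaceCrossing _ _ _).inter ((isLowerSet_dualLRFaceCrossing _ _ _).inter
    ((isLowerSet_dualFaceCrossing _ _ _).inter (isLowerSet_dualLRFaceCrossing _ _ _)))).inter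
    ((isLowerSet_dualFaceCrossing _ _ _).inter ((isLowerSet_dualLRFaceCrossing _ _ _).inter
      ((isLowerSet_dualFaceCrossing _ _ _).inter (isLowerSet_dualLRFaceCrossing _ _ _))))

end Pairs

/-! ### Zone locality of the four parts of the outer-landed event -/

section Locality

variable {ω ω' : BondConfig (Site 2)} {n M : ℕ}

/-- **Transport of an outer-fenced right arm along configurations whose open pairs of the right
zone stay open.** [folklore] -/
def ZdOutOpenArmR.transportZone (A : ZdOutOpenArmR ω n M 0 (M / 64 : ℕ))
    (h : ∀ e : Sym2 (Site 2), (∀ x ∈ e, x ∈ zdSepZoneR n M) → e ∈ ω → e ∈ ω') :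
    ZdOutOpenArmR ω' n M 0 (M / 64 : ℕ) :=
  have hz := A.hz
  have h64 : ((M / 64 : ℕ) : ℤ) ≤ (M / 8 : ℕ) := by exact_mod_cast Nat.div_le_div_left (by norm_num) (by norm_num)
  { A with
    hWo := fun e he => h e (fun v hv => Or.inl (A.hW v (forall_mem_support_of_mem_edges A.W he v hv))) (A.hWo e he)
    hVo := fun e he => h e (fun v hv => by
      obtain ⟨a0, a0', a1⟩ := A.hV v (forall_mem_support_of_mem_edges A.V he v hv)
      have e1 := abs_le.1 a1
      exact Or.inr (Or.inl ⟨by omega, a0', abs_le.2 ⟨by omega, by omega⟩⟩)) (A.hVo e he)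
    hPo := fun e he => h e (fun v hv => by
      obtain ⟨a0, a1⟩ := A.hP v (forall_mem_support_of_mem_edges A.P he v hv)
      have e0 := abs_le.1 (show |v 0 - A.z 0| ≤ (M / 8 : ℕ) by omega)
      have e1 := abs_le.1 (show |v 1 - A.z 1| ≤ (M / 8 : ℕ) by omega)
      exact Or.inr (Or.inl ⟨by omega, by omega, abs_le.2 ⟨by omega, by omega⟩⟩)) (A.hPo e he) }

/-- **Transport of an outer-fenced left arm along the left zone.** [folklore] -/
def ZdOutOpenArmL.transportZone (A : ZdOutOpenArmL ω n M 0 (M / 64 : ℕ))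
    (h : ∀ e : Sym2 (Site 2), (∀ x ∈ e, x ∈ zdSepZoneL n M) → e ∈ ω → e ∈ ω') :
    ZdOutOpenArmL ω' n M 0 (M / 64 : ℕ) :=
  have hz := A.hz
  have h64 : ((M / 64 : ℕ) : ℤ) ≤ (M / 8 : ℕ) := by exact_mod_cast Nat.div_le_div_left (by norm_num) (by norm_num)
  { A with
    hWo := fun e he => h e (fun v hv => Or.inl (A.hW v (forall_mem_support_of_mem_edges A.W he v hv))) (A.hWo e he)
    hVo := fun e he => h e (fun v hv => by
      obtain ⟨a0, a0', a1⟩ := A.hV v (forall_mem_support_of_mem_edges A.V he v hv)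
      have e1 := abs_le.1 a1
      exact Or.inr (Or.inl ⟨by omega, by omega, abs_le.2 ⟨by omega, by omega⟩⟩)) (A.hVo e he)
    hPo := fun e he => h e (fun v hv => by
      obtain ⟨a0, a1⟩ := A.hP v (forall_mem_support_of_mem_edges A.P he v hv)
      have e0 := abs_le.1 (show |v 0 - A.z 0| ≤ (M / 8 : ℕ) by omega)
      have e1 := abs_le.1 (show |v 1 - A.z 1| ≤ (M / 8 : ℕ) by omega)
      exact Or.inr (Or.inl ⟨by omega, by omega, abs_le.2 ⟨by omega, by omega⟩⟩)) (A.hPo e he) }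

/-- **Transport of an outer-fenced top dual arm along configurations whose closed pairs of the top
zone stay closed.** [folklore] -/
def ZdOutDualArmT.transportZone (D : ZdOutDualArmT ω n M 0 (M / 64 : ℕ))
    (h : ∀ e : Sym2 (Site 2), (∀ x ∈ e, x ∈ zdSepZoneT n M) → e ∉ ω → e ∉ ω') :
    ZdOutDualArmT ω' n M 0 (M / 64 : ℕ) :=
  have hg := D.hg
  have h64 : ((M / 64 : ℕ) : ℤ) ≤ (M / 8 : ℕ) := by exact_mod_cast Nat.div_le_div_left (by norm_num) (by norm_num)
  { D with
    hQc := fun d hd => h _ (fun v hv => Or.inl (D.hQa d hd v hv)) (D.hQc d hd)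
    hCc := fun d hd => h _ (fun v hv => by
      obtain ⟨⟨c0, c0'⟩, ⟨c1, c1'⟩⟩ := sepEdge_apply_le hv
      obtain ⟨a0, a1, a1'⟩ := D.hC _ (D.C.dart_fst_mem_support_of_mem_darts hd)
      obtain ⟨b0, b1, b1'⟩ := D.hC _ (D.C.dart_snd_mem_support_of_mem_darts hd)
      have ea := abs_le.1 a0
      have eb := abs_le.1 b0
      refine Or.inr (Or.inl ⟨?_, ?_, ?_, ?_⟩)
      · rcases le_total (d.fst 0) (d.snd 0) with hle | hle
        · rw [max_eq_right hle] at c0; omega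
        · rw [max_eq_left hle] at c0; omega
      · rcases le_total (d.fst 0) (d.snd 0) with hle | hle
        · rw [max_eq_right hle] at c0'; omega
        · rw [max_eq_left hle] at c0'; omega
      · rcases le_total (d.fst 1) (d.snd 1) with hle | hle
        · rw [max_eq_right hle] at c1; omega
        · rw [max_eq_left hle] at c1; omega
      · rcases le_total (d.fst 1) (d.snd 1) with hle | hle
        · rw [max_eq_right hle] at c1'; omega
        · rw [max_eq_left hle] at c1'; omega) (D.hCc d hd)
    hPc := fun d hd => h _ (fun v hv => by
      obtain ⟨⟨c0, c0'⟩, ⟨c1, c1'⟩⟩ := sepEdge_apply_le hv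
      obtain ⟨a0, a1⟩ := D.hP _ (D.P.dart_fst_mem_support_of_mem_darts hd)
      obtain ⟨b0, b1⟩ := D.hP _ (D.P.dart_snd_mem_support_of_mem_darts hd)
      have ea0 := abs_le.1 (show |d.fst 0 - D.g 0| ≤ (M / 8 : ℕ) - 1 by omega)
      have ea1 := abs_le.1 (show |d.fst 1 - D.g 1| ≤ (M / 8 : ℕ) - 1 by omega)
      have eb0 := abs_le.1 (show |d.snd 0 - D.g 0| ≤ (M / 8 : ℕ) - 1 by omega)
      have eb1 := abs_le.1 (show |d.snd 1 - D.g 1| ≤ (M / 8 : ℕ) - 1 by omega)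
      refine Or.inr (Or.inl ⟨?_, ?_, ?_, ?_⟩)
      · rcases le_total (d.fst 0) (d.snd 0) with hle | hle
        · rw [max_eq_right hle] at c0; omega
        · rw [max_eq_left hle] at c0; omega
      · rcases le_total (d.fst 0) (d.snd 0) with hle | hle
        · rw [max_eq_right hle] at c0'; omega
        · rw [max_eq_left hle] at c0'; omega
      · rcases le_total (d.fst 1) (d.snd 1) with hle | hle
        · rw [max_eq_right hle] at c1; omega
        · rw [max_eq_left hle] at c1; omega
      · rcases le_total (d.fst 1) (d.snd 1) with hle | hle
        · rw [max_eq_right hle] at c1'; omega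
        · rw [max_eq_left hle] at c1'; omega) (D.hPc d hd) }

/-- **Transport of an outer-fenced bottom dual arm along the bottom zone.** [folklore] -/
def ZdOutDualArmB.transportZone (D : ZdOutDualArmB ω n M 0 (M / 64 : ℕ))
    (h : ∀ e : Sym2 (Site 2), (∀ x ∈ e, x ∈ zdSepZoneB n M) → e ∉ ω → e ∉ ω') :
    ZdOutDualArmB ω' n M 0 (M / 64 : ℕ) :=
  have hg := D.hg
  have h64 : ((M / 64 : ℕ) : ℤ) ≤ (M / 8 : ℕ) := by exact_mod_cast Nat.div_le_div_left (by norm_num) (by norm_num)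
  { D with
    hQc := fun d hd => h _ (fun v hv => Or.inl (D.hQa d hd v hv)) (D.hQc d hd)
    hCc := fun d hd => h _ (fun v hv => by
      obtain ⟨⟨c0, c0'⟩, ⟨c1, c1'⟩⟩ := sepEdge_apply_le hv
      obtain ⟨a0, a1, a1'⟩ := D.hC _ (D.C.dart_fst_mem_support_of_mem_darts hd)
      obtain ⟨b0, b1, b1'⟩ := D.hC _ (D.C.dart_snd_mem_support_of_mem_darts hd)
      have ea := abs_le.1 a0
      have eb := abs_le.1 b0
      refine Or.inr (Or.inl ⟨?_, ?_, ?_, ?_⟩)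
      · rcases le_total (d.fst 0) (d.snd 0) with hle | hle
        · rw [max_eq_right hle] at c0; omega
        · rw [max_eq_left hle] at c0; omega
      · rcases le_total (d.fst 0) (d.snd 0) with hle | hle
        · rw [max_eq_right hle] at c0'; omega
        · rw [max_eq_left hle] at c0'; omega
      · rcases le_total (d.fst 1) (d.snd 1) with hle | hle
        · rw [max_eq_right hle] at c1; omega
        · rw [max_eq_left hle] at c1; omega
      · rcases le_total (d.fst 1) (d.snd 1) with hle | hle
        · rw [max_eq_right hle] at c1'; omega
        · rw [max_eq_left hle] at c1'; omega) (D.hCc d hd)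
    hPc := fun d hd => h _ (fun v hv => by
      obtain ⟨⟨c0, c0'⟩, ⟨c1, c1'⟩⟩ := sepEdge_apply_le hv
      obtain ⟨a0, a1⟩ := D.hP _ (D.P.dart_fst_mem_support_of_mem_darts hd)
      obtain ⟨b0, b1⟩ := D.hP _ (D.P.dart_snd_mem_support_of_mem_darts hd)
      have ea0 := abs_le.1 (show |d.fst 0 - D.g 0| ≤ (M / 8 : ℕ) - 1 by omega)
      have ea1 := abs_le.1 (show |d.fst 1 - D.g 1| ≤ (M / 8 : ℕ) - 1 by omega)
      have eb0 := abs_le.1 (show |d.snd 0 - D.g 0| ≤ (M / 8 : ℕ) - 1 by omega)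
      have eb1 := abs_le.1 (show |d.snd 1 - D.g 1| ≤ (M / 8 : ℕ) - 1 by omega)
      refine Or.inr (Or.inl ⟨?_, ?_, ?_, ?_⟩)
      · rcases le_total (d.fst 0) (d.snd 0) with hle | hle
        · rw [max_eq_right hle] at c0; omega
        · rw [max_eq_left hle] at c0; omega
      · rcases le_total (d.fst 0) (d.snd 0) with hle | hle
        · rw [max_eq_right hle] at c0'; omega
        · rw [max_eq_left hle] at c0'; omega
      · rcases le_total (d.fst 1) (d.snd 1) with hle | hle
        · rw [max_eq_right hle] at c1; omega
        · rw [max_eq_left hle] at c1; omega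
      · rcases le_total (d.fst 1) (d.snd 1) with hle | hle
        · rw [max_eq_right hle] at c1'; omega
        · rw [max_eq_left hle] at c1'; omega) (D.hPc d hd) }

/-- **The outer-fenced right arm event is determined by the pairs of the right zone.** [folklore] -/
theorem determinedBy_zdOutOpenArmR {F : Set (Sym2 (Site 2))} (hF : (zdSepZoneR n M).sym2 ⊆ F) :
    DeterminedBy (zdOutOpenArmR n M) F := by
  suffices key : ∀ ω ω' : BondConfig (Site 2), ω ∩ F = ω' ∩ F → ω ∈ zdOutOpenArmR n M → ω' ∈ zdOutOpenArmR n M by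
    rw [determinedBy_iff]
    exact fun ω ω' h => ⟨key ω ω' h, key ω' ω h.symm⟩
  rintro ω ω' h ⟨A⟩
  exact ⟨A.transportZone fun e he heω => mem_of_inter_eq h (hF (mem_sym2_of_forall he)) heω⟩

/-- **The outer-fenced left arm event is determined by the pairs of the left zone.** [folklore] -/
theorem determinedBy_zdOutOpenArmL {F : Set (Sym2 (Site 2))} (hF : (zdSepZoneL n M).sym2 ⊆ F) :
    DeterminedBy (zdOutOpenArmL n M) F := by
  suffices key : ∀ ω ω' : BondConfig (Site 2), ω ∩ F = ω' ∩ F → ω ∈ zdOutOpenArmL n M → ω' ∈ zdOutOpenArmL n M by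
    rw [determinedBy_iff]
    exact fun ω ω' h => ⟨key ω ω' h, key ω' ω h.symm⟩
  rintro ω ω' h ⟨A⟩
  exact ⟨A.transportZone fun e he heω => mem_of_inter_eq h (hF (mem_sym2_of_forall he)) heω⟩

/-- **The outer-fenced top dual arm event is determined by the pairs of the top zone.** [folklore] -/
theorem determinedBy_zdOutDualArmT {F : Set (Sym2 (Site 2))} (hF : (zdSepZoneT n M).sym2 ⊆ F) :
    DeterminedBy (zdOutDualArmT n M) F := by
  suffices key : ∀ ω ω' : BondConfig (Site 2), ω ∩ F = ω' ∩ F → ω' ∈ zdOutDualArmT n M → ω ∈ zdOutDualArmT n M by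
    rw [determinedBy_iff]
    exact fun ω ω' h => ⟨key ω' ω h.symm, key ω ω' h⟩
  rintro ω ω' h ⟨D⟩
  exact ⟨D.transportZone fun e he heω' heω => heω' (mem_of_inter_eq h (hF (mem_sym2_of_forall he)) heω)⟩

/-- **The outer-fenced bottom dual arm event is determined by the pairs of the bottom zone.** [folklore] -/
theorem determinedBy_zdOutDualArmB {F : Set (Sym2 (Site 2))} (hF : (zdSepZoneB n M).sym2 ⊆ F) :
    DeterminedBy (zdOutDualArmB n M) F := by
  suffices key : ∀ ω ω' : BondConfig (Site 2), ω ∩ F = ω' ∩ F → ω' ∈ zdOutDualArmB n M → ω ∈ zdOutDualArmB n M by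
    rw [determinedBy_iff]
    exact fun ω ω' h => ⟨key ω' ω h.symm, key ω ω' h⟩
  rintro ω ω' h ⟨D⟩
  exact ⟨D.transportZone fun e he heω' heω => heω' (mem_of_inter_eq h (hF (mem_sym2_of_forall he)) heω)⟩

end Locality

/-! ### RSW and Harris: each class of corridor events has probability `≥ c⁸` -/

section RSW

variable {M M' : ℕ} {c : ℝ}

/-- Harris for `A₁ ∩ (A₂ ∩ (A₃ ∩ A₄))`, increasing events with a common lower bound. [folklore] -/
theorem le_real_inter4'_of_upper {A₁ A₂ A₃ A₄ : Set (BondConfig (Site 2))} (hc0 : 0 ≤ c)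
    (u₁ : IsUpperSet A₁) (u₂ : IsUpperSet A₂) (u₃ : IsUpperSet A₃) (u₄ : IsUpperSet A₄)
    (m₁ : MeasurableSet A₁) (m₂ : MeasurableSet A₂) (m₃ : MeasurableSet A₃) (m₄ : MeasurableSet A₄)
    (h₁ : c ≤ (bondPercolation (zdGraph 2) half).real A₁) (h₂ : c ≤ (bondPercolation (zdGraph 2) half).real A₂)
    (h₃ : c ≤ (bondPercolation (zdGraph 2) half).real A₃) (h₄ : c ≤ (bondPercolation (zdGraph 2) half).real A₄) :
    c ^ 4 ≤ (bondPercolation (zdGraph 2) half).real (A₁ ∩ (A₂ ∩ (A₃ ∩ A₄))) := by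
  have e : c ^ 4 = c * c ^ 3 := by ring
  rw [e]
  exact le_real_inter_of_upper hc0 (by positivity) u₁ (u₂.inter (u₃.inter u₄)) m₁ (m₂.inter (m₃.inter m₄)) h₁
    (le_real_inter3_of_upper hc0 u₂ u₃ u₄ m₂ m₃ m₄ h₂ h₃ h₄)

/-- Harris for `A₁ ∩ (A₂ ∩ (A₃ ∩ A₄))`, decreasing events with a common lower bound. [folklore] -/
theorem le_real_inter4'_of_lower {A₁ A₂ A₃ A₄ : Set (BondConfig (Site 2))} (hc0 : 0 ≤ c)
    (u₁ : IsLowerSet A₁) (u₂ : IsLowerSet A₂) (u₃ : IsLowerSet A₃) (u₄ : IsLowerSet A₄)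
    (m₁ : MeasurableSet A₁) (m₂ : MeasurableSet A₂) (m₃ : MeasurableSet A₃) (m₄ : MeasurableSet A₄)
    (h₁ : c ≤ (bondPercolation (zdGraph 2) half).real A₁) (h₂ : c ≤ (bondPercolation (zdGraph 2) half).real A₂)
    (h₃ : c ≤ (bondPercolation (zdGraph 2) half).real A₃) (h₄ : c ≤ (bondPercolation (zdGraph 2) half).real A₄) :
    c ^ 4 ≤ (bondPercolation (zdGraph 2) half).real (A₁ ∩ (A₂ ∩ (A₃ ∩ A₄))) := by
  have e : c ^ 4 = c * c ^ 3 := by ring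
  rw [e]
  exact le_real_inter_of_lower hc0 (by positivity) u₁ (u₂.inter (u₃.inter u₄)) m₁ (m₂.inter (m₃.inter m₄)) h₁
    (le_real_inter3_of_lower hc0 u₂ u₃ u₄ m₂ m₃ m₄ h₂ h₃ h₄)

/-- **The open corridor events have probability `≥ c⁸`** (`c` the RSW constant at aspect ratio `512`,
`64 ≤ M`). [cite: BollobasRiordan2006, Ch. 3, eq. (3)] -/
theorem le_real_outwardOpenEventsTo (hc0 : 0 < c)
    (hc : ∀ l : ℕ, 1 ≤ l → c ≤ crossingProb half (512 * l - 1) (l - 1)) (hM : 64 ≤ M) (hlo : 2 * M ≤ M')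
    (hhi : M' ≤ 4 * M) :
    c ^ 8 ≤ (bondPercolation (zdGraph 2) half).real (outwardOpenEventsTo M M') := by
  have hc0' := hc0.le
  have e : c ^ 8 = c ^ 4 * c ^ 4 := by ring
  rw [e, outwardOpenEventsTo]
  refine le_real_inter_of_upper (by positivity) (by positivity)
    ((isUpperSet_lrCrossingAt _ _ _).inter ((isUpperSet_lrCrossingAt _ _ _).inter
      ((isUpperSet_tbCrossingAt' _ _ _).inter (isUpperSet_tbCrossingAt' _ _ _))))
    ((isUpperSet_lrCrossingAt _ _ _).inter ((isUpperSet_lrCrossingAt _ _ _).inter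
      ((isUpperSet_tbCrossingAt' _ _ _).inter (isUpperSet_tbCrossingAt' _ _ _))))
    ((measurableSet_lrCrossingAt _ _ _).inter ((measurableSet_lrCrossingAt _ _ _).inter
      ((measurableSet_tbCrossingAt' _ _ _).inter (measurableSet_tbCrossingAt' _ _ _))))
    ((measurableSet_lrCrossingAt _ _ _).inter ((measurableSet_lrCrossingAt _ _ _).inter
      ((measurableSet_tbCrossingAt' _ _ _).inter (measurableSet_tbCrossingAt' _ _ _)))) ?_ ?_
  · exact le_real_inter4'_of_upper hc0' (isUpperSet_lrCrossingAt _ _ _) (isUpperSet_lrCrossingAt _ _ _)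
      (isUpperSet_tbCrossingAt' _ _ _) (isUpperSet_tbCrossingAt' _ _ _) (measurableSet_lrCrossingAt _ _ _)
      (measurableSet_lrCrossingAt _ _ _) (measurableSet_tbCrossingAt' _ _ _) (measurableSet_tbCrossingAt' _ _ _)
      (le_real_lrCrossingAt_of_rsw_ratio hc _ (by omega)) (le_real_lrCrossingAt_of_rsw_ratio hc _ (by omega))
      (le_real_tbCrossingAt'_of_rsw_ratio hc _ (by omega)) (le_real_tbCrossingAt'_of_rsw_ratio hc _ (by omega))
  · exact le_real_inter4'_of_upper hc0' (isUpperSet_lrCrossingAt _ _ _) (isUpperSet_lrCrossingAt _ _ _)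
      (isUpperSet_tbCrossingAt' _ _ _) (isUpperSet_tbCrossingAt' _ _ _) (measurableSet_lrCrossingAt _ _ _)
      (measurableSet_lrCrossingAt _ _ _) (measurableSet_tbCrossingAt' _ _ _) (measurableSet_tbCrossingAt' _ _ _)
      (le_real_lrCrossingAt_of_rsw_ratio hc _ (by omega)) (le_real_lrCrossingAt_of_rsw_ratio hc _ (by omega))
      (le_real_tbCrossingAt'_of_rsw_ratio hc _ (by omega)) (le_real_tbCrossingAt'_of_rsw_ratio hc _ (by omega))

/-- **The dual corridor events have probability `≥ c⁸`.** [cite: BollobasRiordan2006, Ch. 3, eq. (3) and Cor. 3(i)] -/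
theorem le_real_outwardDualEventsTo (hc0 : 0 < c)
    (hc : ∀ l : ℕ, 1 ≤ l → c ≤ crossingProb half (512 * l - 1) (l - 1)) (hM : 64 ≤ M) (hlo : 2 * M ≤ M')
    (hhi : M' ≤ 4 * M) :
    c ^ 8 ≤ (bondPercolation (zdGraph 2) half).real (outwardDualEventsTo M M') := by
  have hc0' := hc0.le
  have e : c ^ 8 = c ^ 4 * c ^ 4 := by ring
  rw [e, outwardDualEventsTo]
  refine le_real_inter_of_lower (by positivity) (by positivity)
    ((isLowerSet_dualFaceCrossing _ _ _).inter ((isLowerSet_dualLRFaceCrossing _ _ _).inter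
      ((isLowerSet_dualFaceCrossing _ _ _).inter (isLowerSet_dualLRFaceCrossing _ _ _))))
    ((isLowerSet_dualFaceCrossing _ _ _).inter ((isLowerSet_dualLRFaceCrossing _ _ _).inter
      ((isLowerSet_dualFaceCrossing _ _ _).inter (isLowerSet_dualLRFaceCrossing _ _ _))))
    ((measurableSet_dualFaceCrossing _ _ _).inter ((measurableSet_dualLRFaceCrossing _ _ _).inter
      ((measurableSet_dualFaceCrossing _ _ _).inter (measurableSet_dualLRFaceCrossing _ _ _))))
    ((measurableSet_dualFaceCrossing _ _ _).inter ((measurableSet_dualLRFaceCrossing _ _ _).inter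
      ((measurableSet_dualFaceCrossing _ _ _).inter (measurableSet_dualLRFaceCrossing _ _ _)))) ?_ ?_
  · exact le_real_inter4'_of_lower hc0' (isLowerSet_dualFaceCrossing _ _ _) (isLowerSet_dualLRFaceCrossing _ _ _)
      (isLowerSet_dualFaceCrossing _ _ _) (isLowerSet_dualLRFaceCrossing _ _ _) (measurableSet_dualFaceCrossing _ _ _)
      (measurableSet_dualLRFaceCrossing _ _ _) (measurableSet_dualFaceCrossing _ _ _) (measurableSet_dualLRFaceCrossing _ _ _)
      (le_real_dualFaceCrossing_of_rsw_ratio hc _ (by omega)) (le_real_dualLRFaceCrossing_of_rsw_ratio hc _ (by omega))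
      (le_real_dualFaceCrossing_of_rsw_ratio hc _ (by omega)) (le_real_dualLRFaceCrossing_of_rsw_ratio hc _ (by omega))
  · exact le_real_inter4'_of_lower hc0' (isLowerSet_dualFaceCrossing _ _ _) (isLowerSet_dualLRFaceCrossing _ _ _)
      (isLowerSet_dualFaceCrossing _ _ _) (isLowerSet_dualLRFaceCrossing _ _ _) (measurableSet_dualFaceCrossing _ _ _)
      (measurableSet_dualLRFaceCrossing _ _ _) (measurableSet_dualFaceCrossing _ _ _) (measurableSet_dualLRFaceCrossing _ _ _)
      (le_real_dualFaceCrossing_of_rsw_ratio hc _ (by omega)) (le_real_dualLRFaceCrossing_of_rsw_ratio hc _ (by omega))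
      (le_real_dualFaceCrossing_of_rsw_ratio hc _ (by omega)) (le_real_dualLRFaceCrossing_of_rsw_ratio hc _ (by omega))

end RSW

/-! ### The generalised FKG inequality and the extension cost -/

section Main

variable {n M M' : ℕ} {c : ℝ}

/-- A site of a dual corridor pair lies in no right/left zone of radius `M`. [folklore] -/
theorem notMem_zoneRL_of_outwardToDualSite (hn : 128 ≤ n) (h2 : 2 * n ≤ M) (hlo : 2 * M ≤ M') (hhi : M' ≤ 4 * M)
    {x : Site 2}
    (hx : |x 0| ≤ 2 * ((M' / 64 : ℕ) : ℤ) + 1 ∧ (M : ℤ) + 1 ≤ |x 1| ∧ |x 1| ≤ (M' : ℤ) + (M' / 8 : ℕ)) :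
    x ∉ zdSepZoneR n M ∪ zdSepZoneL n M := by
  have a0 := abs_le.1 hx.1
  have e1 : (M / 4 : ℕ) + (M / 64 : ℕ) + (M / 64 : ℕ) + (M / 8 : ℕ) ≤ M := by omega
  have e1' : ((M / 4 : ℕ) : ℤ) + (M / 64 : ℕ) + (M / 64 : ℕ) + (M / 8 : ℕ) ≤ M := by exact_mod_cast e1
  have e2 : (n / 4 : ℕ) + (n / 64 : ℕ) + (n / 64 : ℕ) + (n / 8 : ℕ) ≤ M := by omega
  have e2' : ((n / 4 : ℕ) : ℤ) + (n / 64 : ℕ) + (n / 64 : ℕ) + (n / 8 : ℕ) ≤ M := by exact_mod_cast e2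
  rintro (h | h)
  · rcases h with h | ⟨h0, h0', h1'⟩ | ⟨h0, h0', h1'⟩
    · have := coords_of_mem_sqAnnulus (by omega) h
      have b1 := abs_le.2 (show -(M : ℤ) ≤ x 1 ∧ x 1 ≤ M from this.2.1)
      omega
    · omega
    · omega
  · rcases h with h | ⟨h0, h0', h1'⟩ | ⟨h0, h0', h1'⟩
    · have := coords_of_mem_sqAnnulus (by omega) h
      have b1 := abs_le.2 (show -(M : ℤ) ≤ x 1 ∧ x 1 ≤ M from this.2.1)
      omega
    · omega
    · omega

/-- A site of an open corridor pair lies in no top/bottom zone of radius `M`. [folklore] -/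
theorem notMem_zoneTB_of_outwardToOpenSite (hn : 128 ≤ n) (h2 : 2 * n ≤ M) (hlo : 2 * M ≤ M') (hhi : M' ≤ 4 * M)
    {x : Site 2}
    (hx : |x 1| ≤ 2 * ((M' / 64 : ℕ) : ℤ) ∧ (M : ℤ) + 1 ≤ |x 0| ∧ |x 0| + 1 ≤ (M' : ℤ) + (M' / 8 : ℕ)) :
    x ∉ zdSepZoneT n M ∪ zdSepZoneB n M := by
  have a1 := abs_le.1 hx.1
  rintro (h | h)
  · rcases h with h | ⟨h0, h0', h1, h1'⟩ | ⟨h0, h0', h1, h1'⟩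
    · have := coords_of_mem_sqAnnulus (by omega) h
      have b0 := abs_le.2 (show -(M : ℤ) ≤ x 0 ∧ x 0 ≤ M from this.1)
      omega
    · have b0 := abs_le.2 (show -(M : ℤ) ≤ x 0 ∧ x 0 ≤ M from ⟨by omega, by omega⟩)
      omega
    · have b0 := abs_le.2 (show -(M : ℤ) ≤ x 0 ∧ x 0 ≤ M from ⟨by omega, by omega⟩)
      omega
  · rcases h with h | ⟨h0, h0', h1, h1'⟩ | ⟨h0, h0', h1, h1'⟩
    · have := coords_of_mem_sqAnnulus (by omega) h
      have b0 := abs_le.2 (show -(M : ℤ) ≤ x 0 ∧ x 0 ≤ M from this.1)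
      omega
    · have b0 := abs_le.2 (show -(M : ℤ) ≤ x 0 ∧ x 0 ≤ M from ⟨by omega, by omega⟩)
      omega
    · have b0 := abs_le.2 (show -(M : ℤ) ≤ x 0 ∧ x 0 ≤ M from ⟨by omega, by omega⟩)
      omega

/-- **Outward extension, the generalised FKG step** (Nolin 2008, Lemma 13 [arXiv Lemma 12] applied to
the outer-landed event of `A_{n,M}` — an increasing event meet a decreasing one, read off the pairs of
its zones — and the sixteen corridor events at `|x₀| ≥ M+1`, resp. `|x₁| ≥ M+1`): for `128 ≤ n`,
`2n ≤ M` and the RSW constant `c` at aspect ratio `512`,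
`c¹⁶ · P(zdFourArmOutLanded n M) ≤ P(zdFourArmOutLanded n M ∩ (outwardOpenEventsTo M M' ∩ outwardDualEventsTo M M'))`.
[cite: Nolin2008, §4.3 Prop. 12 (i) and Lemma 13 (arXiv 0711.4948: Prop. 11 (i), Lemma 12)] [cite: KestenScalingCMP1987, §2 Lemma 4] -/
theorem real_zdFourArmOutLanded_inter_outwardTo_ge (hn : 128 ≤ n) (h2 : 2 * n ≤ M) (hlo : 2 * M ≤ M')
    (hhi : M' ≤ 4 * M) (hc0 : 0 < c) (hc : ∀ l : ℕ, 1 ≤ l → c ≤ crossingProb half (512 * l - 1) (l - 1)) :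
    c ^ 16 * (bondPercolation (zdGraph 2) half).real (zdFourArmOutLanded n M) ≤
      (bondPercolation (zdGraph 2) half).real
        (zdFourArmOutLanded n M ∩ (outwardOpenEventsTo M M' ∩ outwardDualEventsTo M M')) := by
  classical
  set μ := bondPercolation (zdGraph 2) half with hμ
  set P : Finset (Sym2 (Site 2)) := outwardOpenPairsTo M M' with hP
  set Q : Finset (Sym2 (Site 2)) := outwardDualPairsTo M M' with hQ
  set Z : Set (Site 2) := zdSepZoneR n M ∪ zdSepZoneL n M ∪ (zdSepZoneT n M ∪ zdSepZoneB n M) with hZ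
  set ZS : Finset (Site 2) := (box 2 (M + M / 8 + 1)).filter (· ∈ Z) with hZS
  set S : Finset (Sym2 (Site 2)) := ZS.sym2 \ (P ∪ Q) with hS
  have hSP : Disjoint S P := disjoint_sdiff_self_left.mono_right le_sup_left
  have hSQ : Disjoint S Q := disjoint_sdiff_self_left.mono_right le_sup_right
  have hPQ : Disjoint P Q := disjoint_outwardPairsTo (by omega) hlo hhi
  have hZS_mem : ∀ x ∈ Z, x ∈ ZS := fun x hx => by
    rw [hZS, Finset.mem_filter]
    exact ⟨gl_zone_small_box hn h2 hx, hx⟩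
  have hRL : (zdSepZoneR n M).sym2 ∪ (zdSepZoneL n M).sym2 ⊆ (↑S ∪ ↑P : Set (Sym2 (Site 2))) := by
    intro e he
    have hz : ∀ x ∈ e, x ∈ zdSepZoneR n M ∪ zdSepZoneL n M := fun x hx => by
      rcases he with he | he
      · exact Or.inl (Set.mem_sym2_iff_subset.1 he hx)
      · exact Or.inr (Set.mem_sym2_iff_subset.1 he hx)
    by_cases heP : e ∈ P
    · exact Or.inr heP
    · left
      rw [Finset.mem_coe, hS, Finset.mem_sdiff, Finset.mem_union, Finset.mem_sym2_iff]
      refine ⟨fun x hx => hZS_mem x (Or.inl (hz x hx)), ?_⟩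
      rintro (h | h)
      · exact heP h
      · obtain ⟨x, hx⟩ : ∃ x, x ∈ e := ⟨e.out.1, Sym2.out_fst_mem e⟩
        exact notMem_zoneRL_of_outwardToDualSite hn h2 hlo hhi (outwardDualPairsTo_sites (by omega) hlo hhi h hx) (hz x hx)
  have hTB : (zdSepZoneT n M).sym2 ∪ (zdSepZoneB n M).sym2 ⊆ (↑S ∪ ↑Q : Set (Sym2 (Site 2))) := by
    intro e he
    have hz : ∀ x ∈ e, x ∈ zdSepZoneT n M ∪ zdSepZoneB n M := fun x hx => by
      rcases he with he | he
      · exact Or.inl (Set.mem_sym2_iff_subset.1 he hx)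
      · exact Or.inr (Set.mem_sym2_iff_subset.1 he hx)
    by_cases heQ : e ∈ Q
    · exact Or.inr heQ
    · left
      rw [Finset.mem_coe, hS, Finset.mem_sdiff, Finset.mem_union, Finset.mem_sym2_iff]
      refine ⟨fun x hx => hZS_mem x (Or.inr (hz x hx)), ?_⟩
      rintro (h | h)
      · obtain ⟨x, hx⟩ : ∃ x, x ∈ e := ⟨e.out.1, Sym2.out_fst_mem e⟩
        exact notMem_zoneTB_of_outwardToOpenSite hn h2 hlo hhi (outwardOpenPairsTo_sites (by omega) hlo hhi h hx) (hz x hx)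
      · exact heQ h
  have dAp : DeterminedBy (zdOutOpenArmR n M ∩ zdOutOpenArmL n M) (↑S ∪ ↑P) :=
    (determinedBy_zdOutOpenArmR fun e he => hRL (Or.inl he)).inter
      (determinedBy_zdOutOpenArmL fun e he => hRL (Or.inr he))
  have dAm : DeterminedBy (zdOutDualArmT n M ∩ zdOutDualArmB n M) (↑S ∪ ↑Q) :=
    (determinedBy_zdOutDualArmT fun e he => hTB (Or.inl he)).inter
      (determinedBy_zdOutDualArmB fun e he => hTB (Or.inr he))
  have dBp : DeterminedBy (outwardOpenEventsTo M M') ↑P := determinedBy_outwardOpenEventsTo M M'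
  have dBm : DeterminedBy (outwardDualEventsTo M M') ↑Q := determinedBy_outwardDualEventsTo M M'
  have hFKG := bondPercolation_locallyMonotone_fkg (zdGraph 2) half hSP hSQ hPQ
    (isUpperSet_zdOutOpenArmR_inter_zdOutOpenArmL n M) (isLowerSet_zdOutDualArmT_inter_zdOutDualArmB n M)
    (isUpperSet_outwardOpenEventsTo M M') (isLowerSet_outwardDualEventsTo M M') dAp dAm dBp dBm
  have hBp := le_real_outwardOpenEventsTo hc0 hc (by omega : 64 ≤ M) hlo hhi
  have hBm := le_real_outwardDualEventsTo hc0 hc (by omega : 64 ≤ M) hlo hhi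
  have hset : zdOutOpenArmR n M ∩ zdOutOpenArmL n M ∩ (zdOutDualArmT n M ∩ zdOutDualArmB n M) =
      zdFourArmOutLanded n M := rfl
  rw [hset] at hFKG
  calc c ^ 16 * μ.real (zdFourArmOutLanded n M)
      = μ.real (zdFourArmOutLanded n M) * (c ^ 8 * c ^ 8) := by ring
    _ ≤ μ.real (zdFourArmOutLanded n M) * (μ.real (outwardOpenEventsTo M M') * μ.real (outwardDualEventsTo M M')) :=
        mul_le_mul_of_nonneg_left (mul_le_mul hBp hBm (by positivity) measureReal_nonneg) measureReal_nonneg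
    _ ≤ _ := hFKG

/-- **Outward extension of the outer-landed four-arm event** (Nolin 2008, Prop. 12 (i), external
boundary; Kesten 1987, Lemma 4): `c¹⁶ · P(zdFourArmOutLanded n M) ≤ P(zdFourArmOutLanded n (2M))`
for `128 ≤ n`, `2n ≤ M`, `c` the RSW constant at aspect ratio `512`. [cite: Nolin2008, §4.3 Prop. 12 (i) and §4.4 part 1 (arXiv 0711.4948: Prop. 11 (i), p. 12)] [cite: KestenScalingCMP1987, §2 Lemma 4] -/
theorem real_zdFourArmOutLanded_outwardTo_ge (hn : 128 ≤ n) (h2 : 2 * n ≤ M) (hlo : 2 * M ≤ M') (hhi : M' ≤ 4 * M)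
    (hc0 : 0 < c) (hc : ∀ l : ℕ, 1 ≤ l → c ≤ crossingProb half (512 * l - 1) (l - 1)) :
    c ^ 16 * (bondPercolation (zdGraph 2) half).real (zdFourArmOutLanded n M) ≤
      (bondPercolation (zdGraph 2) half).real (zdFourArmOutLanded n M') := by
  refine (real_zdFourArmOutLanded_inter_outwardTo_ge hn h2 hlo hhi hc0 hc).trans ?_
  refine ENNReal.toReal_mono (measure_ne_top _ _) (measure_mono_ae ?_)
  have hae : ∀ᵐ ω ∂(bondPercolation (zdGraph 2) half), ω ⊆ (zdGraph 2).edgeSet :=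
    ProbabilityTheory.setBernoulli_ae_subset
  filter_upwards [hae] with ω hω h
  exact mem_zdFourArmOutLanded_of_mem_outwardTo hω (by omega) h2 hlo hhi h

/-- **Extension cost of the outer-landed event at doubled outer radius**, packaged: there is
`C₀ ≥ 1` with `P(zdFourArmOutLanded n M) ≤ C₀ · P(zdFourArmOutLanded n (2M))` whenever `128 ≤ n`,
`2n ≤ M` — the hypothesis `hext` of the external summation of Kesten's scheme
(`real_fourArmTwoClusters_le_mul_of_scheme` with `H K = zdFourArmOutLanded n (n · 2^K)`). [cite: Nolin2008, §4.4 part 1 (arXiv 0711.4948 p. 12: "going from ∂S_m to ∂S_{2m} has a cost C'₀ depending only on η'₀")] -/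
theorem exists_real_zdFourArmOutLanded_le_mul_outwardTo :
    ∃ C₀ : ℝ, 1 ≤ C₀ ∧ ∀ n M M' : ℕ, 128 ≤ n → 2 * n ≤ M → 2 * M ≤ M' → M' ≤ 4 * M →
      (bondPercolation (zdGraph 2) half).real (zdFourArmOutLanded n M) ≤
        C₀ * (bondPercolation (zdGraph 2) half).real (zdFourArmOutLanded n M') := by
  obtain ⟨c, hc0, hc⟩ := rsw_lowerBound_holds 512 (by norm_num)
  refine ⟨max 1 (c ^ 16)⁻¹, le_max_left _ _, fun n M M' hn h2 hlo hhi => ?_⟩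
  have h := real_zdFourArmOutLanded_outwardTo_ge hn h2 hlo hhi hc0 hc
  have hc16 : 0 < c ^ 16 := by positivity
  calc (bondPercolation (zdGraph 2) half).real (zdFourArmOutLanded n M)
      = (c ^ 16)⁻¹ * (c ^ 16 * (bondPercolation (zdGraph 2) half).real (zdFourArmOutLanded n M)) := by
        field_simp
    _ ≤ (c ^ 16)⁻¹ * (bondPercolation (zdGraph 2) half).real (zdFourArmOutLanded n M') :=
        mul_le_mul_of_nonneg_left h (by positivity)
    _ ≤ max 1 (c ^ 16)⁻¹ * (bondPercolation (zdGraph 2) half).real (zdFourArmOutLanded n M') :=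
        mul_le_mul_of_nonneg_right (le_max_right _ _) measureReal_nonneg

/-- **Extension cost of the outer-landed event at doubled outer radius** (`M' = 2M`): there is
`C₀ ≥ 1` with `P(zdFourArmOutLanded n M) ≤ C₀ · P(zdFourArmOutLanded n (2M))` whenever `128 ≤ n`,
`2n ≤ M` — the hypothesis `hext` of the external summation of Kesten's scheme
(`real_fourArmTwoClusters_le_mul_of_scheme` with `H K = zdFourArmOutLanded n (n · 2^K)`). [cite: Nolin2008, §4.4 part 1 (arXiv 0711.4948 p. 12)] -/
theorem exists_real_zdFourArmOutLanded_le_mul_outward :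
    ∃ C₀ : ℝ, 1 ≤ C₀ ∧ ∀ n M : ℕ, 128 ≤ n → 2 * n ≤ M →
      (bondPercolation (zdGraph 2) half).real (zdFourArmOutLanded n M) ≤
        C₀ * (bondPercolation (zdGraph 2) half).real (zdFourArmOutLanded n (2 * M)) := by
  obtain ⟨C₀, hC₀, h⟩ := exists_real_zdFourArmOutLanded_le_mul_outwardTo
  exact ⟨C₀, hC₀, fun n M hn h2 => h n M (2 * M) hn h2 le_rfl (by omega)⟩

end Main

end Literature.Probability.Percolation

end
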